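import Summits.QuantumFields.BalabanUV.Gaps.D1PinnedColourRayQuartic
import Summits.QuantumFields.BalabanUV.Gaps.CapTailPinnedLimitSign
import Literature.MathematicalPhysics.QuantumFieldTheory.Balaban1983to89.Beta.ScalewiseWitness

/-!
# `BalabanUV.Gaps.D1PinnedColourRayReadings` — cell pub-balaban-gaps, row (D1), seat g1-p1: THE β-LEAD's PINNED FAMILY ALONG A COLOUR RAY `t ↦ JsBalAn1(r; t·cE, t·cVH, t·cΛ; cE₂; cB; Tc)`:
# STEP KERNELS, (1.22) COEFFICIENTS AND — AT THE PIN `cE₂ := Lc^8`, HYPOTHESIS-FREE — THE LIMIT ONE-LOOP COEFFICIENT ARE QUARTICS IN `t` WITH NO LINEAR TERM; (D1) HOLDS AT ≤ 4 MEMBERS OF A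
# RAY OR AT ALL OF THEM; THE ODD PART OF THE COLOUR RESPONSE IS A PURE CUBE (census row 72b, closing step)

HONEST FRAMING (cell rule, page 1 of everything): [folklore] kernel algebra BY NAME over tree theorems — the siblings `Gaps/D1PinnedColourRayQuartic` (`WbalOf_ray_nodes`), `Gaps/D1PinnedFirstOrderBilinear`
(`certs_zero`), GEN 10's `Gaps/D1PinnedColourScaling` (`S0_colourScale ∕ Sstep_colourScale`), an2's `MixedJetTablesPlug.TbalOf_JsBalAn1` + `BalabanStepW2.vertexFamily₂_WbalOf' ∕ T2Of_loc`,
`BalabanStepJets(Succ).locStencil_S0 ∕ _e3Of ∕ _Sstep ∕ JsBal0Of_S_zero ∕ _succ`, the β sub-cell's `AxialDressing.axVertexOfK ∕ summable_axProj ∕ summable_col_of_decays ∕ vertexFamily_axVertexOfK' ∕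
decays_axDressK`, `TameKernelCalculus` (`Spr ∕ Loc`, `tadpole_add`, `bubble_add_left ∕ _right`), `KernelReflection.bubble_smul_* ∕ tadpole_smul`, `ChartConjugationReflection.wsum_add ∕ abs_le_of_locStencil`,
`ScalewiseWitness.secondMoment_add ∕ _smul ∕ absMoment₂_add`, `OneStepKernelFamily.hTA_TbalOf ∕ decays_KInvStep`, g1-p3's `CapTailPinnedLimitSign.tendsto_pinned ∕ d1Drift_pinned_iff_lim_eq`, Mathlib's
`Polynomial.eq_zero_of_natDegree_lt_card_of_eval_eq_zero'`.  NOTHING of Bałaban's asserted beyond print; [Balaban1987RG1] Thm 2 UNPROVED IN PRINT; which member is print's ((P6)) NOT decided; NO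
coefficient computed or signed; (D1) NOT discharged; 0∕4 row-D1 binders; NOT `BetaPertH`, NOT continuum, NOT Clay.  HONEST DEPENDENCY (b2b cell, verbatim): «continuum YM on T⁴ ⇐ BetaPertH ∧ nine
spine estimates (0/9 proved); BetaPertH ⇐ (D1) ∧ (D4) ∧ CAP+tail; G-an2-4 gates asym, D1 and NE2/3/4.»

WHY.  `TbalOf (JsBalAn1 …) j = ½·tadpole 𝔄_j (W_j b₀ b) − ½·bubble 𝔄_j (V_j b₀) (V_j b)` (`TbalOf_JsBalAn1`).  Along the ray the first-order stencil of member `j` is a QUADRATIC PATH `s²A_j + sB_j` of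
certified families (`S_ray`), so the `Π`-dressed vertex is `s²•V_A + s•V_B` (§1) and the bubble a quartic with no terms of degree `< 2` (§2); `W_j(s)` obeys the sibling's five-node law and the tadpole
is linear on localised kernels; every five-node combination with `Σ wᵢ = 1`, `Σ wᵢ sᵢ^k = t^k` (`k = 2,3,4`) passes through `TbalOf`, `secondMoment` and — at the pin — `CauchyRate.lim`.
CONTENT (all [folklore]; no `def`, no `def … : Prop`, 0 sorry): §1 `summable_abs_axProj_colH`, **`axVertexOfK_add`**, `axVertexOfK_smul`, **`axVertexOfK_path`**, `loc_axVertexOfK`; §2 **`bubble_path`**,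
`bubble_path_nodes`, `tadpole_wsum5`; §3 `S_ray`, `loc_WbalT2Of_an1`, **`TbalOf_JsBalAn1_ray_nodes`** (`1 ≤ Lc`, any `cE₂ cB Tc`, any box root, every level, every entry), `absMoment₂_smul`,
`secondMoment_wsum5`, **`secondMoment_JsBalAn1_ray_nodes`**; §4 (pin, `2 ≤ Lc`) **`lim_JsBalAn1_ray_nodes`**; §5 READINGS: **`lim_ray_fourMembers`** (`lim β⁰(t·c⃗) = Σ_{i=0}^{3} wᵢ(t)·lim β⁰(i·c⃗)`,
`w₁ = t²(t−2)(t−3)/2`, `w₂ = −t²(t−1)(t−3)/4`, `w₃ = t²(t−1)(t−2)/18`, `w₀ = 1 − w₁ − w₂ − w₃`: a QUARTIC IN `t` WITH NO LINEAR TERM), **`d1Drift_ray_of_fourMembers`** ((D1) at `t = 0,1,2,3` ⟹ (D1) on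
the ray), **`d1Drift_ray_dichotomy`** ((D1) at more than four members ⟹ (D1) on the ray), **`lim_ray_oddPart_cube`** (`lim β⁰(t·c⃗) − lim β⁰(−t·c⃗) = t³·(lim β⁰(c⃗) − lim β⁰(−c⃗))`),
`colourPart_noLinearTerm` (`φ(t·c⃗) = t²·q(t)`, `q` explicit).  READING (zero weight): with GEN 10's separation `lim β⁰ = γ(r) + φ(c⃗) + cB·σ(r) + λ(Tc)`, (D1) at the pinned literal is a polynomial
equation of degree ≤ 4 WITHOUT LINEAR PART in the scale of print's first-order colour triple, affine in `cB`, linear in `Tc`.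

Provenance: cell pub-balaban-gaps, seat g1-p1 GEN 12 (prover-pub-balaban-gaps-g1-p1-g12-0), 2026-08-24; imports the unbuilt sibling `Gaps/D1PinnedColourRayQuartic` (DEFERRED at the gate until
its olean builds; CONCAT certificate in the seat records) + built modules; no existing file touched.
-/

noncomputable section

open Finset
open scoped BigOperators
open Literature.MathematicalPhysics.QuantumFieldTheory Balaban1983to89 Balaban1983to89.Beta Filter Topology
open ExpKernelCalculus (MKer Decays BiLoc VertexFamily VertexFamily₂ comp hessKer tadpole bubble)
open OneStepResolventKernel (Fib LocStencil wsum)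
open OneStepKernelFamily (KInvStep decays_KInvStep TbalOf D1Drift hTA_TbalOf colH)
open DecimatedMomentSummable (AbsMoment₂)
open BalabanStepJets (S0 locStencil_S0)
open BalabanStepJetsSucc (JsBal0Of Sstep e3Of wE locStencil_e3Of locStencil_Sstep JsBal0Of_S_zero JsBal0Of_S_succ)
open BalabanStepW2 (WbalOf T2Of T2Of_loc WbalT2Of vertexFamily₂_WbalOf')
open StepJetData (locStencil_smul)
open AxialProjector (axProj)
open AxialDressing (axDressK axVertexOfK decays_axDressK summable_axProj summable_col_of_decays vertexFamily_axVertexOfK')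
open KernelReflection (bubble_smul_left bubble_smul_right tadpole_smul)
open AffineAveraging (box toSite)
open AveragingMixedJetTables (vh₂SAt mixFFAt)
open RateCertificate (CauchyRate)
open ScalewiseWitness (secondMoment_add secondMoment_smul absMoment₂_add)
open Summit.QuantumFields.BalabanUV.Beta.TameKernelCalculus (Spr Loc tadpole_add bubble_add_left bubble_add_right)
open Summit.QuantumFields.BalabanUV.Beta.ChartConjugationReflection (wsum_add abs_le_of_locStencil)
open Summit.QuantumFields.BalabanUV.Beta.MixedJetTablesPlug (JsBalAn1 TbalOf_JsBalAn1 hB_an1 hmix_an1)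
open Summit.QuantumFields.BalabanUV.Beta.GAN24.StencilSlotOfE3 (one_le_of_two_le)
open Summit.QuantumFields.BalabanUV.Gaps.CapTailPinnedLimitSign (tendsto_pinned d1Drift_pinned_iff_lim_eq)
open Summit.QuantumFields.BalabanUV.Gaps.D1PinnedFirstOrderBilinear (certs_zero)
open Summit.QuantumFields.BalabanUV.Gaps.D1PinnedColourScaling (S0_colourScale Sstep_colourScale)
open Summit.QuantumFields.BalabanUV.Gaps.D1PinnedColourRayQuartic (WbalOf_ray_nodes)

namespace Summit.QuantumFields.BalabanUV.Gaps.D1PinnedColourRayReadings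

variable {d : ℕ} {N : ℕ}

/-! ## §1 The `Π`-dressed chain-rule vertex is additive in its stencil family; along a quadratic path it is a quadratic path of localised kernels -/

/-- [folklore] The `Π`-dressed `ℋ`-column weights of a decaying kernel are absolutely summable (`AxialDressing.summable_axProj` on the summable `ℋ`-column
`summable_col_of_decays`, `summable_abs_iff` on `ℝ`). -/
theorem summable_abs_axProj_colH (hN : 1 ≤ N) {K : MKer (d + 1) (Fib d)} {C δ : ℝ} (hK : Decays K C δ) (hδ : 0 < δ) (μ : Fin (d + 1))
    (y : Fin (d + 1) → ℤ) (κ' : Fin (d + 1)) : Summable fun u => |axProj N (colH K N μ y) κ' u| :=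
  summable_abs_iff.mpr (summable_axProj hN (fun κ => summable_col_of_decays hK hδ ((N : ℤ) • y) (Sum.inl κ) (Sum.inr μ)) κ')

/-- [folklore] **THE `Π`-DRESSED CHAIN-RULE VERTEX IS ADDITIVE IN ITS STENCIL FAMILY** (decaying `K`, bounded families): `V^Π_K(A + B) = V^Π_K(A) + V^Π_K(B)`
(`ChartConjugationReflection.wsum_add` leg by leg). -/
theorem axVertexOfK_add (hN : 1 ≤ N) {K : MKer (d + 1) (Fib d)} {C δ : ℝ} (hK : Decays K C δ) (hδ : 0 < δ)
    {A B : Fin (d + 1) → (Fin (d + 1) → ℤ) → MKer (d + 1) (Fib d)} {BA BB : ℝ} (hA : ∀ κ u x z a b, |A κ u x z a b| ≤ BA) (hB : ∀ κ u x z a b, |B κ u x z a b| ≤ BB)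
    (μ : Fin (d + 1)) (y : Fin (d + 1) → ℤ) :
    axVertexOfK K N (fun κ u => A κ u + B κ u) μ y = axVertexOfK K N A μ y + axVertexOfK K N B μ y := by
  have hA' : ∀ κ u x z a b, |A κ u x z a b| ≤ max BA BB := fun κ u x z a b => (hA κ u x z a b).trans (le_max_left _ _)
  have hB' : ∀ κ u x z a b, |B κ u x z a b| ≤ max BA BB := fun κ u x z a b => (hB κ u x z a b).trans (le_max_right _ _)
  funext x z a b
  simp only [AxialDressing.axVertexOfK, Pi.add_apply]
  rw [← Finset.sum_add_distrib]
  refine Finset.sum_congr rfl fun κ' _ => ?_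
  have e := wsum_add (summable_abs_axProj_colH hN hK hδ μ y κ') (hA' κ') (hB' κ')
  have e' := congrFun (congrFun (congrFun (congrFun e x) z) a) b
  simpa only [Pi.add_apply] using e'

/-- [folklore] `V^Π_K(t • A) = t • V^Π_K(A)` (finite sum of `tsum`s, no hypothesis; twin of GEN 10's `D1PinnedFirstOrderQuadratic.axVertexOfK_scale` on built imports). -/
theorem axVertexOfK_smul (K : MKer (d + 1) (Fib d)) (N : ℕ) (t : ℝ) (A : Fin (d + 1) → (Fin (d + 1) → ℤ) → MKer (d + 1) (Fib d)) (μ : Fin (d + 1))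
    (y : Fin (d + 1) → ℤ) : axVertexOfK K N (fun κ u => t • A κ u) μ y = t • axVertexOfK K N A μ y := by
  funext x z a b
  simp only [AxialDressing.axVertexOfK, OneStepResolventKernel.wsum, Pi.smul_apply, smul_eq_mul]
  rw [Finset.mul_sum]
  refine Finset.sum_congr rfl fun κ' _ => ?_
  rw [← tsum_mul_left]
  exact tsum_congr fun u => by ring

/-- [folklore] **ALONG A QUADRATIC PATH OF CERTIFIED STENCIL FAMILIES THE `Π`-DRESSED VERTEX IS A QUADRATIC PATH OF KERNELS**:
`V^Π_K(s²A + sB) b = s² • V^Π_K(A) b + s • V^Π_K(B) b` (decaying `K`; `A, B` local stencil families). -/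
theorem axVertexOfK_path (hN : 1 ≤ N) {K : MKer (d + 1) (Fib d)} {C δ : ℝ} (hK : Decays K C δ) (hδ : 0 < δ)
    {A B : Fin (d + 1) → (Fin (d + 1) → ℤ) → MKer (d + 1) (Fib d)} (hA : ∃ C δ : ℝ, 0 < δ ∧ LocStencil A C δ) (hB : ∃ C δ : ℝ, 0 < δ ∧ LocStencil B C δ)
    (s : ℝ) (μ : Fin (d + 1)) (y : Fin (d + 1) → ℤ) :
    axVertexOfK K N (fun κ u => s ^ 2 • A κ u + s • B κ u) μ y = s ^ 2 • axVertexOfK K N A μ y + s • axVertexOfK K N B μ y := by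
  obtain ⟨CA, δA, hδA, hAl⟩ := hA
  obtain ⟨CB, δB, hδB, hBl⟩ := hB
  have bA : ∀ κ u x z a b, |(s ^ 2 • A κ u) x z a b| ≤ |s ^ 2| * CA := fun κ u x z a b => by
    rw [Pi.smul_apply, Pi.smul_apply, Pi.smul_apply, Pi.smul_apply, smul_eq_mul, abs_mul]
    exact mul_le_mul_of_nonneg_left (abs_le_of_locStencil hAl hδA.le κ u x z a b) (abs_nonneg _)
  have bB : ∀ κ u x z a b, |(s • B κ u) x z a b| ≤ |s| * CB := fun κ u x z a b => by
    rw [Pi.smul_apply, Pi.smul_apply, Pi.smul_apply, Pi.smul_apply, smul_eq_mul, abs_mul]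
    exact mul_le_mul_of_nonneg_left (abs_le_of_locStencil hBl hδB.le κ u x z a b) (abs_nonneg _)
  rw [axVertexOfK_add hN hK hδ bA bB, axVertexOfK_smul, axVertexOfK_smul]

/-- [folklore] The `Π`-dressed vertex of a certified stencil family through a decaying `K` is a localised kernel (`vertexFamily_axVertexOfK'`). -/
theorem loc_axVertexOfK [NeZero N] {K : MKer (d + 1) (Fib d)} (hK : ∃ δ C : ℝ, 0 < δ ∧ 0 ≤ C ∧ Decays K C δ)
    {A : Fin (d + 1) → (Fin (d + 1) → ℤ) → MKer (d + 1) (Fib d)} (hA : ∃ C δ : ℝ, 0 < δ ∧ LocStencil A C δ) (μ : Fin (d + 1)) (y : Fin (d + 1) → ℤ) :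
    Loc (axVertexOfK K N A μ y) := by
  obtain ⟨CA, δA, hδA, hAl⟩ := hA
  obtain ⟨Cv, δv, hδv, hV⟩ := vertexFamily_axVertexOfK' (N := N) hK hAl hδA
  exact ⟨_, _, _, _, hδv, hV μ y⟩

/-! ## §2 The bubble along a quadratic path of localised vertices is a quartic with no terms of degree `< 2`; weighted five-sums through bubble and tadpole -/

section Traces

variable {D : ℕ} {F : Type*} [Fintype F]

/-- [folklore] **THE BUBBLE ALONG A QUADRATIC PATH**: for spread `𝔄` and localised `a, b, a′, b′`,
`bubble 𝔄 (s²a + sb) (s²a′ + sb′) = s⁴·bubble 𝔄 a a′ + s³·(bubble 𝔄 a b′ + bubble 𝔄 b a′) + s²·bubble 𝔄 b b′`. -/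
theorem bubble_path {𝔄 a b a' b' : MKer D F} (h𝔄 : Spr 𝔄) (ha : Loc a) (hb : Loc b) (ha' : Loc a') (hb' : Loc b') (s : ℝ) :
    bubble 𝔄 (s ^ 2 • a + s • b) (s ^ 2 • a' + s • b') =
      s ^ 4 * bubble 𝔄 a a' + s ^ 3 * (bubble 𝔄 a b' + bubble 𝔄 b a') + s ^ 2 * bubble 𝔄 b b' := by
  rw [bubble_add_left h𝔄 (ha.smul _) (hb.smul _) ((ha'.smul _).add (hb'.smul _)), bubble_add_right h𝔄 (ha.smul _) (ha'.smul _) (hb'.smul _),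
    bubble_add_right h𝔄 (hb.smul _) (ha'.smul _) (hb'.smul _)]
  simp only [bubble_smul_left, bubble_smul_right]
  ring

/-- [folklore] **THE FIVE-NODE IDENTITY FOR THE BUBBLE ALONG A QUADRATIC PATH**: with weights of moments `Σ wᵢ sᵢ^k = t^k` (`k = 2, 3, 4`; NO zeroth or first moment is needed),
`bubble 𝔄 (x(t)) (x′(t)) = Σ wᵢ · bubble 𝔄 (x(sᵢ)) (x′(sᵢ))`, `x(s) = s²a + sb`, `x′(s) = s²a′ + sb′`. -/
theorem bubble_path_nodes {𝔄 a b a' b' : MKer D F} (h𝔄 : Spr 𝔄) (ha : Loc a) (hb : Loc b) (ha' : Loc a') (hb' : Loc b')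
    (t s₀ s₁ s₂ s₃ s₄ w₀ w₁ w₂ w₃ w₄ : ℝ) (hm2 : w₀ * s₀ ^ 2 + w₁ * s₁ ^ 2 + w₂ * s₂ ^ 2 + w₃ * s₃ ^ 2 + w₄ * s₄ ^ 2 = t ^ 2)
    (hm3 : w₀ * s₀ ^ 3 + w₁ * s₁ ^ 3 + w₂ * s₂ ^ 3 + w₃ * s₃ ^ 3 + w₄ * s₄ ^ 3 = t ^ 3) (hm4 : w₀ * s₀ ^ 4 + w₁ * s₁ ^ 4 + w₂ * s₂ ^ 4 + w₃ * s₃ ^ 4 + w₄ * s₄ ^ 4 = t ^ 4) :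
    bubble 𝔄 (t ^ 2 • a + t • b) (t ^ 2 • a' + t • b') =
      w₀ * bubble 𝔄 (s₀ ^ 2 • a + s₀ • b) (s₀ ^ 2 • a' + s₀ • b') + w₁ * bubble 𝔄 (s₁ ^ 2 • a + s₁ • b) (s₁ ^ 2 • a' + s₁ • b') +
        w₂ * bubble 𝔄 (s₂ ^ 2 • a + s₂ • b) (s₂ ^ 2 • a' + s₂ • b') + w₃ * bubble 𝔄 (s₃ ^ 2 • a + s₃ • b) (s₃ ^ 2 • a' + s₃ • b') +
        w₄ * bubble 𝔄 (s₄ ^ 2 • a + s₄ • b) (s₄ ^ 2 • a' + s₄ • b') := by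
  simp only [bubble_path h𝔄 ha hb ha' hb']
  linear_combination (-(bubble 𝔄 a a')) * hm4 - (bubble 𝔄 a b' + bubble 𝔄 b a') * hm3 - bubble 𝔄 b b' * hm2

/-- [folklore] **THE TADPOLE OF A WEIGHTED FIVE-SUM OF LOCALISED KERNELS** (spread `𝔄`): `tadpole 𝔄 (Σ wᵢ • Xᵢ) = Σ wᵢ · tadpole 𝔄 Xᵢ` (`tadpole_add` ×4, `tadpole_smul` ×5). -/
theorem tadpole_wsum5 {𝔄 X₀ X₁ X₂ X₃ X₄ : MKer D F} (h𝔄 : Spr 𝔄) (h₀ : Loc X₀) (h₁ : Loc X₁) (h₂ : Loc X₂) (h₃ : Loc X₃) (h₄ : Loc X₄) (w₀ w₁ w₂ w₃ w₄ : ℝ) :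
    tadpole 𝔄 (w₀ • X₀ + w₁ • X₁ + w₂ • X₂ + w₃ • X₃ + w₄ • X₄) =
      w₀ * tadpole 𝔄 X₀ + w₁ * tadpole 𝔄 X₁ + w₂ * tadpole 𝔄 X₂ + w₃ * tadpole 𝔄 X₃ + w₄ * tadpole 𝔄 X₄ := by
  rw [tadpole_add h𝔄 ((((h₀.smul w₀).add (h₁.smul w₁)).add (h₂.smul w₂)).add (h₃.smul w₃)) (h₄.smul w₄),
    tadpole_add h𝔄 (((h₀.smul w₀).add (h₁.smul w₁)).add (h₂.smul w₂)) (h₃.smul w₃), tadpole_add h𝔄 ((h₀.smul w₀).add (h₁.smul w₁)) (h₂.smul w₂),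
    tadpole_add h𝔄 (h₀.smul w₀) (h₁.smul w₁), tadpole_smul, tadpole_smul, tadpole_smul, tadpole_smul, tadpole_smul]

end Traces

/-! ## §3 The pinned family's step kernels and (1.22) coefficients along a colour ray in the five-node form (`1 ≤ Lc`, any `cE₂ cB Tc`, any box root) -/

section Kernels

variable {Lc : ℕ} [NeZero Lc]

/-- [folklore] **THE FIRST-ORDER STENCIL OF an2's JET DATUM ALONG A COLOUR RAY IS A QUADRATIC PATH OF CERTIFIED FAMILIES** (every level, whatever second-order tables the datum carries):
member `0`: `S₀(s·c⃗) = s²•0 + s•S₀(c⃗)` (`S0_colourScale`, `locStencil_S0`); member `j+1`: `S_{j+1}(s·c⃗) = s²•((cE·wE)•e3Of c⃗) + s•S_{j+1}(0,cVH,cΛ)` (`Sstep_colourScale`, `locStencil_e3Of`,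
`locStencil_Sstep`). -/
theorem S_ray (hLc : 1 ≤ Lc) (cE cVH cΛ : ℝ) : ∀ j : ℕ, ∃ A B : Fin (d + 1) → (Fin (d + 1) → ℤ) → MKer (d + 1) (Fib d),
    (∃ C δ : ℝ, 0 < δ ∧ LocStencil A C δ) ∧ (∃ C δ : ℝ, 0 < δ ∧ LocStencil B C δ) ∧
      ∀ (s : ℝ) (W : ℕ → Fin (d + 1) → (Fin (d + 1) → ℤ) → Fin (d + 1) → (Fin (d + 1) → ℤ) → MKer (d + 1) (Fib d)) (Cw δw : ℕ → ℝ) (hδw : ∀ j, 0 < δw j)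
        (hW : ∀ j, VertexFamily₂ (W j) Lc (Cw j) (δw j)),
        (JsBal0Of hLc (s * cE) (s * cVH) (s * cΛ) W Cw δw hδw hW j).S = fun κ u => s ^ 2 • A κ u + s • B κ u
  | 0 => ⟨fun _ _ => 0, S0 d Lc cE cVH cΛ, (certs_zero (d := d) (N := Lc)).1, locStencil_S0 hLc cE cVH cΛ, fun s W Cw δw hδw hW => by
      rw [JsBal0Of_S_zero, S0_colourScale]; funext κ u; simp⟩
  | j + 1 => by
    obtain ⟨C₁, δ₁, hδ₁, h1⟩ := locStencil_e3Of (d := d) (Lc := Lc) hLc cE cVH cΛ (j + 1)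
    exact ⟨fun κ u => (cE * wE d Lc (j + 1)) • e3Of d Lc cE cVH cΛ (j + 1) κ u, Sstep d Lc 0 cVH cΛ (j + 1), ⟨_, δ₁, hδ₁, locStencil_smul _ h1⟩,
      locStencil_Sstep hLc 0 cVH cΛ (j + 1), fun s W Cw δw hδw hW => by funext κ u; rw [JsBal0Of_S_succ, Sstep_colourScale]⟩

variable {r : Fin (3 + 1) → ℕ}

/-- [folklore] The pinned family's second-order table at any colour triple is localised at every bond pair (`vertexFamily₂_WbalOf'` at an1's certificates). -/
theorem loc_WbalT2Of_an1 (hLc : 1 ≤ Lc) (hr : r ∈ box (3 + 1) Lc) (cE cVH cΛ cE₂ cB : ℝ) (T : Fin 4 → Fin 4 → Fin 4 → Fin 4 → ℝ) (j : ℕ)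
    (μ : Fin 4) (y : Fin 4 → ℤ) (ν : Fin 4) (y' : Fin 4 → ℤ) :
    Loc (WbalT2Of (Lc := Lc) cE cVH cΛ cE₂ cB T (vh₂S := vh₂SAt (toSite r) Lc) (mixFF := mixFFAt (toSite r) Lc) j μ y ν y') := by
  obtain ⟨Cw, δw, hδw, hW⟩ := vertexFamily₂_WbalOf' (d := 3) hLc cE cVH cΛ (T2Of_loc (d := 3) hLc cE cVH cΛ cE₂ cB T (hB_an1 hLc hr) (hmix_an1 hLc hr)) (hmix_an1 hLc hr) j
  exact ⟨_, _, _, _, hδw, hW μ y ν y'⟩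

/-- [folklore] **THE PINNED FAMILY's STEP KERNELS ALONG A COLOUR RAY IN THE FIVE-NODE FORM** (`1 ≤ Lc`; any `cE₂, cB, Tc`; any box root; every level `j`; every entry): for all nodes
`s₀,…,s₄` and weights with `Σ wᵢ = 1`, `Σ wᵢ sᵢ^k = t^k` (`k = 2,3,4`),
`TbalOf (JsBalAn1 r (t·c⃗) cE₂ cB Tc) j μ ν z = Σᵢ wᵢ · TbalOf (JsBalAn1 r (sᵢ·c⃗) cE₂ cB Tc) j μ ν z` — `TbalOf_JsBalAn1` (closed `Π`-form), `S_ray` + `axVertexOfK_path` (the bubble legs are the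
quadratic path `s²•V_A + s•V_B`), `bubble_path_nodes`, the sibling's `WbalOf_ray_nodes` + `tadpole_wsum5` (the tadpole slot). -/
theorem TbalOf_JsBalAn1_ray_nodes (hLc : 1 ≤ Lc) (hr : r ∈ box (3 + 1) Lc) (cE cVH cΛ cE₂ cB : ℝ) (T : Fin 4 → Fin 4 → Fin 4 → Fin 4 → ℝ) (j : ℕ)
    (t s₀ s₁ s₂ s₃ s₄ w₀ w₁ w₂ w₃ w₄ : ℝ) (hm0 : w₀ + w₁ + w₂ + w₃ + w₄ = 1) (hm2 : w₀ * s₀ ^ 2 + w₁ * s₁ ^ 2 + w₂ * s₂ ^ 2 + w₃ * s₃ ^ 2 + w₄ * s₄ ^ 2 = t ^ 2)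
    (hm3 : w₀ * s₀ ^ 3 + w₁ * s₁ ^ 3 + w₂ * s₂ ^ 3 + w₃ * s₃ ^ 3 + w₄ * s₄ ^ 3 = t ^ 3) (hm4 : w₀ * s₀ ^ 4 + w₁ * s₁ ^ 4 + w₂ * s₂ ^ 4 + w₃ * s₃ ^ 4 + w₄ * s₄ ^ 4 = t ^ 4)
    (μ ν : Fin 4) (z : Fin 4 → ℤ) :
    TbalOf Lc (JsBalAn1 hLc hr (t * cE) (t * cVH) (t * cΛ) cE₂ cB T) j μ ν z =
      w₀ * TbalOf Lc (JsBalAn1 hLc hr (s₀ * cE) (s₀ * cVH) (s₀ * cΛ) cE₂ cB T) j μ ν z + w₁ * TbalOf Lc (JsBalAn1 hLc hr (s₁ * cE) (s₁ * cVH) (s₁ * cΛ) cE₂ cB T) j μ ν z +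
        w₂ * TbalOf Lc (JsBalAn1 hLc hr (s₂ * cE) (s₂ * cVH) (s₂ * cΛ) cE₂ cB T) j μ ν z + w₃ * TbalOf Lc (JsBalAn1 hLc hr (s₃ * cE) (s₃ * cVH) (s₃ * cΛ) cE₂ cB T) j μ ν z +
        w₄ * TbalOf Lc (JsBalAn1 hLc hr (s₄ * cE) (s₄ * cVH) (s₄ * cΛ) cE₂ cB T) j μ ν z := by
  obtain ⟨A, B, hA, hB, hS⟩ := S_ray (d := 3) (Lc := Lc) hLc cE cVH cΛ j
  have hK := decays_KInvStep (Lc := Lc) (d := 3) j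
  obtain ⟨δK, CK, hδK, -, hKd⟩ := id hK
  have h𝔄 : Spr (axDressK Lc (KInvStep (d := 3) Lc j)) := ⟨_, δK, hδK, decays_axDressK hLc hKd hδK.le⟩
  have lA : ∀ b : Fin 4 × (Fin 4 → ℤ), Loc (axVertexOfK (KInvStep (d := 3) Lc j) Lc A b.1 b.2) := fun b => loc_axVertexOfK hK hA b.1 b.2
  have lB : ∀ b : Fin 4 × (Fin 4 → ℤ), Loc (axVertexOfK (KInvStep (d := 3) Lc j) Lc B b.1 b.2) := fun b => loc_axVertexOfK hK hB b.1 b.2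
  have hV : ∀ (s : ℝ) (b : Fin 4 × (Fin 4 → ℤ)), axVertexOfK (KInvStep (d := 3) Lc j) Lc (fun κ u => s ^ 2 • A κ u + s • B κ u) b.1 b.2 =
      s ^ 2 • axVertexOfK (KInvStep (d := 3) Lc j) Lc A b.1 b.2 + s • axVertexOfK (KInvStep (d := 3) Lc j) Lc B b.1 b.2 :=
    fun s b => axVertexOfK_path hLc hKd hδK hA hB s b.1 b.2
  -- the tadpole slot: the sibling's five-node law for the assembled second-order family, read at the bond pair `(μ,0;ν,z)`
  have hW := WbalOf_ray_nodes (d := 3) hLc cE cVH cΛ cE₂ cB T (hB_an1 hLc hr) (hmix_an1 hLc hr) j t s₀ s₁ s₂ s₃ s₄ w₀ w₁ w₂ w₃ w₄ hm0 hm2 hm3 hm4 μ 0 ν z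
  have htad := tadpole_wsum5 h𝔄 (loc_WbalT2Of_an1 hLc hr (s₀ * cE) (s₀ * cVH) (s₀ * cΛ) cE₂ cB T j μ 0 ν z) (loc_WbalT2Of_an1 hLc hr (s₁ * cE) (s₁ * cVH) (s₁ * cΛ) cE₂ cB T j μ 0 ν z)
    (loc_WbalT2Of_an1 hLc hr (s₂ * cE) (s₂ * cVH) (s₂ * cΛ) cE₂ cB T j μ 0 ν z) (loc_WbalT2Of_an1 hLc hr (s₃ * cE) (s₃ * cVH) (s₃ * cΛ) cE₂ cB T j μ 0 ν z)
    (loc_WbalT2Of_an1 hLc hr (s₄ * cE) (s₄ * cVH) (s₄ * cΛ) cE₂ cB T j μ 0 ν z) w₀ w₁ w₂ w₃ w₄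
  unfold BalabanStepW2.WbalT2Of at htad
  rw [← hW] at htad
  -- the bubble slot
  have hbub := bubble_path_nodes h𝔄 (lA (μ, 0)) (lB (μ, 0)) (lA (ν, z)) (lB (ν, z)) t s₀ s₁ s₂ s₃ s₄ w₀ w₁ w₂ w₃ w₄ hm2 hm3 hm4
  rw [TbalOf_JsBalAn1 hLc hr (t * cE) (t * cVH) (t * cΛ) cE₂ cB T j, TbalOf_JsBalAn1 hLc hr (s₀ * cE) (s₀ * cVH) (s₀ * cΛ) cE₂ cB T j,
    TbalOf_JsBalAn1 hLc hr (s₁ * cE) (s₁ * cVH) (s₁ * cΛ) cE₂ cB T j, TbalOf_JsBalAn1 hLc hr (s₂ * cE) (s₂ * cVH) (s₂ * cΛ) cE₂ cB T j,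
    TbalOf_JsBalAn1 hLc hr (s₃ * cE) (s₃ * cVH) (s₃ * cΛ) cE₂ cB T j, TbalOf_JsBalAn1 hLc hr (s₄ * cE) (s₄ * cVH) (s₄ * cΛ) cE₂ cB T j,
    hS t, hS s₀, hS s₁, hS s₂, hS s₃, hS s₄]
  simp only [ExpKernelCalculus.hessKer]
  unfold BalabanStepW2.WbalT2Of
  rw [hV t (μ, 0), hV t (ν, z), hV s₀ (μ, 0), hV s₀ (ν, z), hV s₁ (μ, 0), hV s₁ (ν, z), hV s₂ (μ, 0), hV s₂ (ν, z), hV s₃ (μ, 0), hV s₃ (ν, z),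
    hV s₄ (μ, 0), hV s₄ (ν, z)]
  linear_combination (1 / 2 : ℝ) * htad - (1 / 2 : ℝ) * hbub

/-- [folklore] `AbsMoment₂` is stable under scaling. -/
theorem absMoment₂_smul {f : (Fin 4 → ℤ) → ℝ} (hf : AbsMoment₂ f) (c : ℝ) : AbsMoment₂ (c • f) := by
  unfold DecimatedMomentSummable.AbsMoment₂ at hf ⊢
  refine (hf.mul_left |c|).congr fun y => ?_
  rw [Pi.smul_apply, smul_eq_mul, abs_mul]
  ring

/-- [folklore] The (1.22) second moment of a weighted five-sum of kernels with absolutely summable second moments. -/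
theorem secondMoment_wsum5 {P₀ P₁ P₂ P₃ P₄ : Fin 4 → Fin 4 → (Fin 4 → ℤ) → ℝ} (h₀ : ∀ c e, AbsMoment₂ (P₀ c e)) (h₁ : ∀ c e, AbsMoment₂ (P₁ c e))
    (h₂ : ∀ c e, AbsMoment₂ (P₂ c e)) (h₃ : ∀ c e, AbsMoment₂ (P₃ c e)) (h₄ : ∀ c e, AbsMoment₂ (P₄ c e)) (w₀ w₁ w₂ w₃ w₄ : ℝ) (μ ν : Fin 4) :
    B12Beta.secondMoment (w₀ • P₀ + w₁ • P₁ + w₂ • P₂ + w₃ • P₃ + w₄ • P₄) μ ν =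
      w₀ * B12Beta.secondMoment P₀ μ ν + w₁ * B12Beta.secondMoment P₁ μ ν + w₂ * B12Beta.secondMoment P₂ μ ν + w₃ * B12Beta.secondMoment P₃ μ ν +
        w₄ * B12Beta.secondMoment P₄ μ ν := by
  have sm : ∀ {P : Fin 4 → Fin 4 → (Fin 4 → ℤ) → ℝ} (w : ℝ), (∀ c e, AbsMoment₂ (P c e)) → ∀ c e, AbsMoment₂ ((w • P) c e) := fun w h c e => absMoment₂_smul (h c e) w
  have s₀ := sm w₀ h₀; have s₁ := sm w₁ h₁; have s₂ := sm w₂ h₂; have s₃ := sm w₃ h₃; have s₄ := sm w₄ h₄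
  have p₁ : ∀ c e, AbsMoment₂ ((w₀ • P₀ + w₁ • P₁) c e) := fun c e => absMoment₂_add (s₀ c e) (s₁ c e)
  have p₂ : ∀ c e, AbsMoment₂ ((w₀ • P₀ + w₁ • P₁ + w₂ • P₂) c e) := fun c e => absMoment₂_add (p₁ c e) (s₂ c e)
  have p₃ : ∀ c e, AbsMoment₂ ((w₀ • P₀ + w₁ • P₁ + w₂ • P₂ + w₃ • P₃) c e) := fun c e => absMoment₂_add (p₂ c e) (s₃ c e)
  rw [secondMoment_add p₃ s₄, secondMoment_add p₂ s₃, secondMoment_add p₁ s₂, secondMoment_add s₀ s₁, secondMoment_smul, secondMoment_smul, secondMoment_smul,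
    secondMoment_smul, secondMoment_smul]

/-- [folklore] **THE PINNED FAMILY's ONE-LOOP STEP COEFFICIENTS ALONG A COLOUR RAY IN THE FIVE-NODE FORM** (`1 ≤ Lc`; any `cE₂, cB, Tc`; any box root; every level; every channel):
`β⁰_j(r, t·c⃗) = Σᵢ wᵢ · β⁰_j(r, sᵢ·c⃗)` for weights of moments `Σ wᵢ = 1`, `Σ wᵢ sᵢ^k = t^k` (`k = 2,3,4`). -/
theorem secondMoment_JsBalAn1_ray_nodes (hLc : 1 ≤ Lc) (hr : r ∈ box (3 + 1) Lc) (cE cVH cΛ cE₂ cB : ℝ) (T : Fin 4 → Fin 4 → Fin 4 → Fin 4 → ℝ) (j : ℕ)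
    (t s₀ s₁ s₂ s₃ s₄ w₀ w₁ w₂ w₃ w₄ : ℝ) (hm0 : w₀ + w₁ + w₂ + w₃ + w₄ = 1) (hm2 : w₀ * s₀ ^ 2 + w₁ * s₁ ^ 2 + w₂ * s₂ ^ 2 + w₃ * s₃ ^ 2 + w₄ * s₄ ^ 2 = t ^ 2)
    (hm3 : w₀ * s₀ ^ 3 + w₁ * s₁ ^ 3 + w₂ * s₂ ^ 3 + w₃ * s₃ ^ 3 + w₄ * s₄ ^ 3 = t ^ 3) (hm4 : w₀ * s₀ ^ 4 + w₁ * s₁ ^ 4 + w₂ * s₂ ^ 4 + w₃ * s₃ ^ 4 + w₄ * s₄ ^ 4 = t ^ 4)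
    (μ ν : Fin 4) :
    B12Beta.secondMoment (TbalOf Lc (JsBalAn1 hLc hr (t * cE) (t * cVH) (t * cΛ) cE₂ cB T) j) μ ν =
      w₀ * B12Beta.secondMoment (TbalOf Lc (JsBalAn1 hLc hr (s₀ * cE) (s₀ * cVH) (s₀ * cΛ) cE₂ cB T) j) μ ν +
        w₁ * B12Beta.secondMoment (TbalOf Lc (JsBalAn1 hLc hr (s₁ * cE) (s₁ * cVH) (s₁ * cΛ) cE₂ cB T) j) μ ν +
        w₂ * B12Beta.secondMoment (TbalOf Lc (JsBalAn1 hLc hr (s₂ * cE) (s₂ * cVH) (s₂ * cΛ) cE₂ cB T) j) μ ν +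
        w₃ * B12Beta.secondMoment (TbalOf Lc (JsBalAn1 hLc hr (s₃ * cE) (s₃ * cVH) (s₃ * cΛ) cE₂ cB T) j) μ ν +
        w₄ * B12Beta.secondMoment (TbalOf Lc (JsBalAn1 hLc hr (s₄ * cE) (s₄ * cVH) (s₄ * cΛ) cE₂ cB T) j) μ ν := by
  have hker : TbalOf Lc (JsBalAn1 hLc hr (t * cE) (t * cVH) (t * cΛ) cE₂ cB T) j =
      w₀ • TbalOf Lc (JsBalAn1 hLc hr (s₀ * cE) (s₀ * cVH) (s₀ * cΛ) cE₂ cB T) j + w₁ • TbalOf Lc (JsBalAn1 hLc hr (s₁ * cE) (s₁ * cVH) (s₁ * cΛ) cE₂ cB T) j +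
        w₂ • TbalOf Lc (JsBalAn1 hLc hr (s₂ * cE) (s₂ * cVH) (s₂ * cΛ) cE₂ cB T) j + w₃ • TbalOf Lc (JsBalAn1 hLc hr (s₃ * cE) (s₃ * cVH) (s₃ * cΛ) cE₂ cB T) j +
        w₄ • TbalOf Lc (JsBalAn1 hLc hr (s₄ * cE) (s₄ * cVH) (s₄ * cΛ) cE₂ cB T) j := by
    funext μ' ν' z
    simp only [Pi.add_apply, Pi.smul_apply, smul_eq_mul]
    exact TbalOf_JsBalAn1_ray_nodes hLc hr cE cVH cΛ cE₂ cB T j t s₀ s₁ s₂ s₃ s₄ w₀ w₁ w₂ w₃ w₄ hm0 hm2 hm3 hm4 μ' ν' z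
  rw [hker]
  exact secondMoment_wsum5 (hTA_TbalOf _ j) (hTA_TbalOf _ j) (hTA_TbalOf _ j) (hTA_TbalOf _ j) (hTA_TbalOf _ j) w₀ w₁ w₂ w₃ w₄ μ ν

end Kernels

/-! ## §4 UNCONDITIONAL at the pin `cE₂ := Lc^8`, `2 ≤ Lc`: the limit one-loop coefficient along a colour ray in the five-node form -/

section Pinned

variable {Lc : ℕ} [NeZero Lc] {r : Fin (3 + 1) → ℕ}

/-- [folklore] **THE LIMIT ONE-LOOP COEFFICIENT ALONG A COLOUR RAY IN THE FIVE-NODE FORM, HYPOTHESIS-FREE** (pin `cE₂ := Lc^8`, `2 ≤ Lc`; any box root, `cB`, `Tc`, channel):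
`lim β⁰(r, t·c⃗; cB, Tc) = Σᵢ wᵢ · lim β⁰(r, sᵢ·c⃗; cB, Tc)` for weights of moments `Σ wᵢ = 1`, `Σ wᵢ sᵢ^k = t^k` (`k = 2,3,4`) — §3 at every level + g1-p3's `tendsto_pinned` ×6 + `tendsto_nhds_unique`. -/
theorem lim_JsBalAn1_ray_nodes (hLc : 2 ≤ Lc) (hr : r ∈ box (3 + 1) Lc) (cE cVH cΛ cB : ℝ) (Tc : Fin 4 → Fin 4 → Fin 4 → Fin 4 → ℝ)
    (t s₀ s₁ s₂ s₃ s₄ w₀ w₁ w₂ w₃ w₄ : ℝ) (hm0 : w₀ + w₁ + w₂ + w₃ + w₄ = 1) (hm2 : w₀ * s₀ ^ 2 + w₁ * s₁ ^ 2 + w₂ * s₂ ^ 2 + w₃ * s₃ ^ 2 + w₄ * s₄ ^ 2 = t ^ 2)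
    (hm3 : w₀ * s₀ ^ 3 + w₁ * s₁ ^ 3 + w₂ * s₂ ^ 3 + w₃ * s₃ ^ 3 + w₄ * s₄ ^ 3 = t ^ 3) (hm4 : w₀ * s₀ ^ 4 + w₁ * s₁ ^ 4 + w₂ * s₂ ^ 4 + w₃ * s₃ ^ 4 + w₄ * s₄ ^ 4 = t ^ 4)
    (μ ν : Fin 4) :
    CauchyRate.lim (fun j => B12Beta.secondMoment (TbalOf Lc (JsBalAn1 (one_le_of_two_le hLc) hr (t * cE) (t * cVH) (t * cΛ) ((Lc : ℝ) ^ (2 * (3 + 1))) cB Tc) j) μ ν) =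
      w₀ * CauchyRate.lim (fun j => B12Beta.secondMoment (TbalOf Lc (JsBalAn1 (one_le_of_two_le hLc) hr (s₀ * cE) (s₀ * cVH) (s₀ * cΛ) ((Lc : ℝ) ^ (2 * (3 + 1))) cB Tc) j) μ ν) +
        w₁ * CauchyRate.lim (fun j => B12Beta.secondMoment (TbalOf Lc (JsBalAn1 (one_le_of_two_le hLc) hr (s₁ * cE) (s₁ * cVH) (s₁ * cΛ) ((Lc : ℝ) ^ (2 * (3 + 1))) cB Tc) j) μ ν) +
        w₂ * CauchyRate.lim (fun j => B12Beta.secondMoment (TbalOf Lc (JsBalAn1 (one_le_of_two_le hLc) hr (s₂ * cE) (s₂ * cVH) (s₂ * cΛ) ((Lc : ℝ) ^ (2 * (3 + 1))) cB Tc) j) μ ν) +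
        w₃ * CauchyRate.lim (fun j => B12Beta.secondMoment (TbalOf Lc (JsBalAn1 (one_le_of_two_le hLc) hr (s₃ * cE) (s₃ * cVH) (s₃ * cΛ) ((Lc : ℝ) ^ (2 * (3 + 1))) cB Tc) j) μ ν) +
        w₄ * CauchyRate.lim (fun j => B12Beta.secondMoment (TbalOf Lc (JsBalAn1 (one_le_of_two_le hLc) hr (s₄ * cE) (s₄ * cVH) (s₄ * cΛ) ((Lc : ℝ) ^ (2 * (3 + 1))) cB Tc) j) μ ν) := by
  have ht := tendsto_pinned hLc hr (t * cE) (t * cVH) (t * cΛ) cB Tc μ ν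
  have h₀ := tendsto_pinned hLc hr (s₀ * cE) (s₀ * cVH) (s₀ * cΛ) cB Tc μ ν
  have h₁ := tendsto_pinned hLc hr (s₁ * cE) (s₁ * cVH) (s₁ * cΛ) cB Tc μ ν
  have h₂ := tendsto_pinned hLc hr (s₂ * cE) (s₂ * cVH) (s₂ * cΛ) cB Tc μ ν
  have h₃ := tendsto_pinned hLc hr (s₃ * cE) (s₃ * cVH) (s₃ * cΛ) cB Tc μ ν
  have h₄ := tendsto_pinned hLc hr (s₄ * cE) (s₄ * cVH) (s₄ * cΛ) cB Tc μ ν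
  exact tendsto_nhds_unique ht ((((((h₀.const_mul w₀).add (h₁.const_mul w₁)).add (h₂.const_mul w₂)).add (h₃.const_mul w₃)).add (h₄.const_mul w₄)).congr
    fun j => (secondMoment_JsBalAn1_ray_nodes (one_le_of_two_le hLc) hr cE cVH cΛ _ cB Tc j t s₀ s₁ s₂ s₃ s₄ w₀ w₁ w₂ w₃ w₄ hm0 hm2 hm3 hm4 μ ν).symm)

/-! ## §5 Readings -/

/-- [folklore] **FOUR MEMBERS GIVE THE WHOLE RAY — THE LIMIT ALONG A COLOUR RAY IS A QUARTIC IN `t` WITH NO LINEAR TERM, HYPOTHESIS-FREE**: `lim β⁰(r, t·c⃗; cB, Tc) = Σ_{i=0}^{3} wᵢ(t)·lim β⁰(r, i·c⃗; cB, Tc)`,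
`w₁ = t²(t−2)(t−3)/2`, `w₂ = −t²(t−1)(t−3)/4`, `w₃ = t²(t−1)(t−2)/18`, `w₀ = 1 − w₁ − w₂ − w₃` (moments `k = 0,2,3,4` by `ring`; no fifth node needed because there is no linear term). -/
theorem lim_ray_fourMembers (hLc : 2 ≤ Lc) (hr : r ∈ box (3 + 1) Lc) (cE cVH cΛ cB : ℝ) (Tc : Fin 4 → Fin 4 → Fin 4 → Fin 4 → ℝ) (μ ν : Fin 4) (t : ℝ) :
    CauchyRate.lim (fun j => B12Beta.secondMoment (TbalOf Lc (JsBalAn1 (one_le_of_two_le hLc) hr (t * cE) (t * cVH) (t * cΛ) ((Lc : ℝ) ^ (2 * (3 + 1))) cB Tc) j) μ ν) =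
      (1 - t ^ 2 * (t - 2) * (t - 3) / 2 + t ^ 2 * (t - 1) * (t - 3) / 4 - t ^ 2 * (t - 1) * (t - 2) / 18) *
          CauchyRate.lim (fun j => B12Beta.secondMoment (TbalOf Lc (JsBalAn1 (one_le_of_two_le hLc) hr 0 0 0 ((Lc : ℝ) ^ (2 * (3 + 1))) cB Tc) j) μ ν) +
        t ^ 2 * (t - 2) * (t - 3) / 2 * CauchyRate.lim (fun j => B12Beta.secondMoment (TbalOf Lc (JsBalAn1 (one_le_of_two_le hLc) hr cE cVH cΛ ((Lc : ℝ) ^ (2 * (3 + 1))) cB Tc) j) μ ν) +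
        -(t ^ 2 * (t - 1) * (t - 3) / 4) *
          CauchyRate.lim (fun j => B12Beta.secondMoment (TbalOf Lc (JsBalAn1 (one_le_of_two_le hLc) hr (2 * cE) (2 * cVH) (2 * cΛ) ((Lc : ℝ) ^ (2 * (3 + 1))) cB Tc) j) μ ν) +
        t ^ 2 * (t - 1) * (t - 2) / 18 *
          CauchyRate.lim (fun j => B12Beta.secondMoment (TbalOf Lc (JsBalAn1 (one_le_of_two_le hLc) hr (3 * cE) (3 * cVH) (3 * cΛ) ((Lc : ℝ) ^ (2 * (3 + 1))) cB Tc) j) μ ν) := by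
  have h := lim_JsBalAn1_ray_nodes hLc hr cE cVH cΛ cB Tc t 0 1 2 3 0 (1 - t ^ 2 * (t - 2) * (t - 3) / 2 + t ^ 2 * (t - 1) * (t - 3) / 4 - t ^ 2 * (t - 1) * (t - 2) / 18)
    (t ^ 2 * (t - 2) * (t - 3) / 2) (-(t ^ 2 * (t - 1) * (t - 3) / 4)) (t ^ 2 * (t - 1) * (t - 2) / 18) 0 (by ring) (by ring) (by ring) (by ring) μ ν
  simp only [zero_mul, one_mul, add_zero] at h
  exact h

/-- [folklore] **(D1) AT THE FOUR MEMBERS `t = 0, 1, 2, 3` OF A COLOUR RAY IS (D1) ON THE WHOLE RAY, HYPOTHESIS-FREE** (same root, `cB`, `Tc`, numeral `N`, channel): the limit is a quartic with no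
linear term (previous theorem) and the four weights sum to `1` (g1-p3's `d1Drift_pinned_iff_lim_eq` ×5). -/
theorem d1Drift_ray_of_fourMembers (hLc : 2 ≤ Lc) (hr : r ∈ box (3 + 1) Lc) (cE cVH cΛ cB : ℝ) (Tc : Fin 4 → Fin 4 → Fin 4 → Fin 4 → ℝ) (μ ν : Fin 4) (N : ℝ)
    (h0 : D1Drift Lc (JsBalAn1 (one_le_of_two_le hLc) hr 0 0 0 ((Lc : ℝ) ^ (2 * (3 + 1))) cB Tc) N μ ν)
    (h1 : D1Drift Lc (JsBalAn1 (one_le_of_two_le hLc) hr cE cVH cΛ ((Lc : ℝ) ^ (2 * (3 + 1))) cB Tc) N μ ν)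
    (h2 : D1Drift Lc (JsBalAn1 (one_le_of_two_le hLc) hr (2 * cE) (2 * cVH) (2 * cΛ) ((Lc : ℝ) ^ (2 * (3 + 1))) cB Tc) N μ ν)
    (h3 : D1Drift Lc (JsBalAn1 (one_le_of_two_le hLc) hr (3 * cE) (3 * cVH) (3 * cΛ) ((Lc : ℝ) ^ (2 * (3 + 1))) cB Tc) N μ ν) (t : ℝ) :
    D1Drift Lc (JsBalAn1 (one_le_of_two_le hLc) hr (t * cE) (t * cVH) (t * cΛ) ((Lc : ℝ) ^ (2 * (3 + 1))) cB Tc) N μ ν := by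
  rw [d1Drift_pinned_iff_lim_eq hLc hr] at h0 h1 h2 h3 ⊢
  rw [lim_ray_fourMembers hLc hr cE cVH cΛ cB Tc μ ν t, h0, h1, h2, h3]
  ring

open Polynomial in
/-- [folklore] A real function of the four-member form of `lim_ray_fourMembers` (a quartic with no linear term) that takes the value `c` at more than four points is constantly `c`
(`Polynomial.eq_zero_of_natDegree_lt_card_of_eval_eq_zero'`, `compute_degree`). -/
theorem quartic_noLinear_dichotomy (f : ℝ → ℝ) (L₀ L₁ L₂ L₃ c : ℝ)
    (hf : ∀ t, f t = (1 - t ^ 2 * (t - 2) * (t - 3) / 2 + t ^ 2 * (t - 1) * (t - 3) / 4 - t ^ 2 * (t - 1) * (t - 2) / 18) * L₀ +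
        t ^ 2 * (t - 2) * (t - 3) / 2 * L₁ + -(t ^ 2 * (t - 1) * (t - 3) / 4) * L₂ + t ^ 2 * (t - 1) * (t - 2) / 18 * L₃)
    (S : Finset ℝ) (hS : 4 < S.card) (hD : ∀ s ∈ S, f s = c) (t : ℝ) : f t = c := by
  let p : Polynomial ℝ := (1 - X ^ 2 * (X - 2) * (X - 3) * C (1 / 2 : ℝ) + X ^ 2 * (X - 1) * (X - 3) * C (1 / 4 : ℝ) - X ^ 2 * (X - 1) * (X - 2) * C (1 / 18 : ℝ)) * C L₀ +
    X ^ 2 * (X - 2) * (X - 3) * C (1 / 2 : ℝ) * C L₁ - X ^ 2 * (X - 1) * (X - 3) * C (1 / 4 : ℝ) * C L₂ + X ^ 2 * (X - 1) * (X - 2) * C (1 / 18 : ℝ) * C L₃ - C c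
  have hev : ∀ s : ℝ, p.eval s = f s - c := fun s => by
    rw [hf s]; simp only [p, eval_add, eval_sub, eval_mul, eval_pow, eval_C, eval_X, eval_one, eval_ofNat]; ring
  have hdeg : p.natDegree ≤ 4 := by simp only [p]; compute_degree!
  have hp : p = 0 :=
    Polynomial.eq_zero_of_natDegree_lt_card_of_eval_eq_zero' p S (fun s hs => by rw [hev s, sub_eq_zero]; exact hD s hs) (lt_of_le_of_lt hdeg hS)
  have ht := hev t
  rw [hp, eval_zero] at ht
  exact sub_eq_zero.mp ht.symm

/-- [folklore] **THE RAY DICHOTOMY, HYPOTHESIS-FREE: (D1) HOLDS AT NO MORE THAN FOUR MEMBERS OF A COLOUR RAY, OR AT ALL OF THEM** (same root, `cB`, `Tc`, numeral, channel): if the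
drift criterion holds on a finite set of more than four ray parameters, it holds at every `t` (`lim_ray_fourMembers` + `quartic_noLinear_dichotomy` + `d1Drift_pinned_iff_lim_eq`). -/
theorem d1Drift_ray_dichotomy (hLc : 2 ≤ Lc) (hr : r ∈ box (3 + 1) Lc) (cE cVH cΛ cB : ℝ) (Tc : Fin 4 → Fin 4 → Fin 4 → Fin 4 → ℝ) (μ ν : Fin 4) (N : ℝ)
    (S : Finset ℝ) (hS : 4 < S.card) (hD : ∀ s ∈ S, D1Drift Lc (JsBalAn1 (one_le_of_two_le hLc) hr (s * cE) (s * cVH) (s * cΛ) ((Lc : ℝ) ^ (2 * (3 + 1))) cB Tc) N μ ν) (t : ℝ) :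
    D1Drift Lc (JsBalAn1 (one_le_of_two_le hLc) hr (t * cE) (t * cVH) (t * cΛ) ((Lc : ℝ) ^ (2 * (3 + 1))) cB Tc) N μ ν :=
  (d1Drift_pinned_iff_lim_eq hLc hr _ _ _ cB Tc μ ν N).mpr (quartic_noLinear_dichotomy
    (f := fun s => CauchyRate.lim (fun j => B12Beta.secondMoment (TbalOf Lc (JsBalAn1 (one_le_of_two_le hLc) hr (s * cE) (s * cVH) (s * cΛ) ((Lc : ℝ) ^ (2 * (3 + 1))) cB Tc) j) μ ν))
    _ _ _ _ (B12Normalization.stepBal N Lc) (fun s => lim_ray_fourMembers hLc hr cE cVH cΛ cB Tc μ ν s) S hS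
    (fun s hs => (d1Drift_pinned_iff_lim_eq hLc hr _ _ _ cB Tc μ ν N).mp (hD s hs)) t)

/-- [folklore] **THE ODD PART OF THE COLOUR RESPONSE IS A PURE CUBE, HYPOTHESIS-FREE**: `lim β⁰(r, t·c⃗; cB, Tc) − lim β⁰(r, −t·c⃗; cB, Tc) = t³·(lim β⁰(r, c⃗; cB, Tc) − lim β⁰(r, −c⃗; cB, Tc))`
— nodes `(−t, 1, −1)`, weights `(1, t³, −t³)` (moments `1; t²; t³; t⁴`); in particular NO LINEAR TERM in the colour scale. -/
theorem lim_ray_oddPart_cube (hLc : 2 ≤ Lc) (hr : r ∈ box (3 + 1) Lc) (cE cVH cΛ cB : ℝ) (Tc : Fin 4 → Fin 4 → Fin 4 → Fin 4 → ℝ) (μ ν : Fin 4) (t : ℝ) :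
    CauchyRate.lim (fun j => B12Beta.secondMoment (TbalOf Lc (JsBalAn1 (one_le_of_two_le hLc) hr (t * cE) (t * cVH) (t * cΛ) ((Lc : ℝ) ^ (2 * (3 + 1))) cB Tc) j) μ ν) -
        CauchyRate.lim (fun j => B12Beta.secondMoment (TbalOf Lc (JsBalAn1 (one_le_of_two_le hLc) hr (-t * cE) (-t * cVH) (-t * cΛ) ((Lc : ℝ) ^ (2 * (3 + 1))) cB Tc) j) μ ν) =
      t ^ 3 * (CauchyRate.lim (fun j => B12Beta.secondMoment (TbalOf Lc (JsBalAn1 (one_le_of_two_le hLc) hr cE cVH cΛ ((Lc : ℝ) ^ (2 * (3 + 1))) cB Tc) j) μ ν) -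
        CauchyRate.lim (fun j => B12Beta.secondMoment (TbalOf Lc (JsBalAn1 (one_le_of_two_le hLc) hr (-cE) (-cVH) (-cΛ) ((Lc : ℝ) ^ (2 * (3 + 1))) cB Tc) j) μ ν)) := by
  have h := lim_JsBalAn1_ray_nodes hLc hr cE cVH cΛ cB Tc t (-t) 1 (-1) 0 0 1 (t ^ 3) (-(t ^ 3)) 0 0 (by ring) (by ring) (by ring) (by ring) μ ν
  simp only [zero_mul, one_mul, add_zero, neg_one_mul] at h
  linear_combination h

/-- [folklore] **THE COLOUR CORRECTION VANISHES TO SECOND ORDER AT THE COLOUR-FREE MEMBER, HYPOTHESIS-FREE**: `φ_r(t·c⃗) := lim β⁰(r, t·c⃗; cB, Tc) − lim β⁰(r, 0⃗; cB, Tc) = t² · q(t)` with the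
explicit quadratic `q(t) = a₂ + a₃t + a₄t²`, `a₂ = −85/36·L₀ + 3·L₁ − 3/4·L₂ + 1/9·L₃`, `a₃ = 5/3·L₀ − 5/2·L₁ + L₂ − 1/6·L₃`, `a₄ = −11/36·L₀ + 1/2·L₁ − 1/4·L₂ + 1/18·L₃` in the member values
`L_i := lim β⁰(r, i·c⃗; cB, Tc)` (`i = 0,1,2,3`) — `lim_ray_fourMembers` expanded. -/
theorem colourPart_noLinearTerm (hLc : 2 ≤ Lc) (hr : r ∈ box (3 + 1) Lc) (cE cVH cΛ cB : ℝ) (Tc : Fin 4 → Fin 4 → Fin 4 → Fin 4 → ℝ) (μ ν : Fin 4) (t : ℝ) :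
    CauchyRate.lim (fun j => B12Beta.secondMoment (TbalOf Lc (JsBalAn1 (one_le_of_two_le hLc) hr (t * cE) (t * cVH) (t * cΛ) ((Lc : ℝ) ^ (2 * (3 + 1))) cB Tc) j) μ ν) -
        CauchyRate.lim (fun j => B12Beta.secondMoment (TbalOf Lc (JsBalAn1 (one_le_of_two_le hLc) hr 0 0 0 ((Lc : ℝ) ^ (2 * (3 + 1))) cB Tc) j) μ ν) =
      t ^ 2 * ((-(85 / 36 : ℝ) * CauchyRate.lim (fun j => B12Beta.secondMoment (TbalOf Lc (JsBalAn1 (one_le_of_two_le hLc) hr 0 0 0 ((Lc : ℝ) ^ (2 * (3 + 1))) cB Tc) j) μ ν) +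
            3 * CauchyRate.lim (fun j => B12Beta.secondMoment (TbalOf Lc (JsBalAn1 (one_le_of_two_le hLc) hr cE cVH cΛ ((Lc : ℝ) ^ (2 * (3 + 1))) cB Tc) j) μ ν) -
            (3 / 4 : ℝ) * CauchyRate.lim (fun j => B12Beta.secondMoment (TbalOf Lc (JsBalAn1 (one_le_of_two_le hLc) hr (2 * cE) (2 * cVH) (2 * cΛ) ((Lc : ℝ) ^ (2 * (3 + 1))) cB Tc) j) μ ν) +
            (1 / 9 : ℝ) * CauchyRate.lim (fun j => B12Beta.secondMoment (TbalOf Lc (JsBalAn1 (one_le_of_two_le hLc) hr (3 * cE) (3 * cVH) (3 * cΛ) ((Lc : ℝ) ^ (2 * (3 + 1))) cB Tc) j) μ ν)) +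
          t * ((5 / 3 : ℝ) * CauchyRate.lim (fun j => B12Beta.secondMoment (TbalOf Lc (JsBalAn1 (one_le_of_two_le hLc) hr 0 0 0 ((Lc : ℝ) ^ (2 * (3 + 1))) cB Tc) j) μ ν) -
            (5 / 2 : ℝ) * CauchyRate.lim (fun j => B12Beta.secondMoment (TbalOf Lc (JsBalAn1 (one_le_of_two_le hLc) hr cE cVH cΛ ((Lc : ℝ) ^ (2 * (3 + 1))) cB Tc) j) μ ν) +
            CauchyRate.lim (fun j => B12Beta.secondMoment (TbalOf Lc (JsBalAn1 (one_le_of_two_le hLc) hr (2 * cE) (2 * cVH) (2 * cΛ) ((Lc : ℝ) ^ (2 * (3 + 1))) cB Tc) j) μ ν) -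
            (1 / 6 : ℝ) * CauchyRate.lim (fun j => B12Beta.secondMoment (TbalOf Lc (JsBalAn1 (one_le_of_two_le hLc) hr (3 * cE) (3 * cVH) (3 * cΛ) ((Lc : ℝ) ^ (2 * (3 + 1))) cB Tc) j) μ ν)) +
          t ^ 2 * (-(11 / 36 : ℝ) * CauchyRate.lim (fun j => B12Beta.secondMoment (TbalOf Lc (JsBalAn1 (one_le_of_two_le hLc) hr 0 0 0 ((Lc : ℝ) ^ (2 * (3 + 1))) cB Tc) j) μ ν) +
            (1 / 2 : ℝ) * CauchyRate.lim (fun j => B12Beta.secondMoment (TbalOf Lc (JsBalAn1 (one_le_of_two_le hLc) hr cE cVH cΛ ((Lc : ℝ) ^ (2 * (3 + 1))) cB Tc) j) μ ν) -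
            (1 / 4 : ℝ) * CauchyRate.lim (fun j => B12Beta.secondMoment (TbalOf Lc (JsBalAn1 (one_le_of_two_le hLc) hr (2 * cE) (2 * cVH) (2 * cΛ) ((Lc : ℝ) ^ (2 * (3 + 1))) cB Tc) j) μ ν) +
            (1 / 18 : ℝ) * CauchyRate.lim (fun j => B12Beta.secondMoment (TbalOf Lc (JsBalAn1 (one_le_of_two_le hLc) hr (3 * cE) (3 * cVH) (3 * cΛ) ((Lc : ℝ) ^ (2 * (3 + 1))) cB Tc) j) μ ν))) := by
  rw [lim_ray_fourMembers hLc hr cE cVH cΛ cB Tc μ ν t]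
  ring

end Pinned

end Summit.QuantumFields.BalabanUV.Gaps.D1PinnedColourRayReadings

end
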